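import Summits.HodgeConjecture.HodgeConjecture.Theses.HeckePrymWeil
import Summits.HodgeConjecture.HodgeConjecture.Theorems.HeckePrymWeilWeilDescendingUpward
import Summits.HodgeConjecture.HodgeConjecture.Theorems.HeckePrymWeilProductDescentTransfer
import Literature.AlgebraicGeometry.HodgeTheory.ComplexConjugationHolds
import Literature.AlgebraicGeometry.HodgeTheory.AlgebraicClassesCupAbelianVariety
import Literature.AlgebraicGeometry.HodgeTheory.HodgeTypePullback
import Literature.AlgebraicGeometry.HodgeTheory.CupPreservesHodgeTypeOfDeRham
import Literature.AlgebraicGeometry.HodgeTheory.HodgeFiltrationModelsReductionProofs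
import Literature.AlgebraicGeometry.Motives.ComplexPointsOrientation
import Literature.AlgebraicGeometry.Motives.HyperbolicWeilType
import Literature.AlgebraicGeometry.Motives.AbelianVarietyProductDimProofs
import Literature.AlgebraicGeometry.Motives.AimedSplitProduct

/-!
# `AimedDescending` (stmt-HodgeConjecture-14643) · IV · the lever from two named Literature facts

Route `HeckePrymWeil`, support item `AimedDescending` (the LEVER of the split of
`WeilSixfoldsSqrtMinus7`, general in the prime `p ≡ 3 (4)`, `p ≥ 7` and the half-dimension
`n ≥ 1`): IF the Hodge–Weil classes are algebraic on every SPLIT `ℚ(√-p)`-Weil abelian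
`(2n+2)`-fold — hyperbolic (`Motives.IsHyperbolicWeilType`) for the `K`-symmetrised hyperplane
class `p·ι^*a + Φ^*ι^*a` of some projective embedding — THEN they are algebraic on EVERY
`ℚ(√-p)`-Weil abelian `2n`-fold (C. Schoen, Compositio Math. 114 (1998), Addendum §10; K. Koike,
Canad. Math. Bull. 47 (2004) Thm. 2.1; E. Markman, arXiv:2509.23403 §11.5 Step 2, printed for
`6 → 4`; B. van Geemen, LNM 1594 (1994), 5.2–5.4; Landherr 1936).

Files I–III of the item (`HeckePrymWeilAimedDescending`, `…Frame`, `…Aiming`) reduced the lever to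
the aimed partner (P) and the pointwise descent (D) and proved the arithmetic and the frame
transport. This file proves the route decl `Theses.HeckePrymWeil.AimedDescending` from exactly
TWO named Literature facts:

* `exists_cmWeilSurface_aimedSplitProduct_of_ne_one_of_ne_three` — the AIMING half of the product
  trick in the route's polarised typing (Markman §11.5 Step 2 / van Geemen 5.2 (3), 5.3, 5.4 /
  Schoen §10): one CM Weil surface `(B, ψ)` with a DESCENT PAIR `(b₊, b₋, η)` such that for every
  Weil-type `(A, φ)` of every even dimension `A × B` is of hyperbolic Weil type for the
  `K`-symmetrised hyperplane class of some projective embedding. This is the CORRECTED (guarded,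
  `d ≠ 1`, `d ≠ 3`) form of `Motives.exists_cmWeilSurface_aimedSplitProduct`, which the tree
  records as false at `d ∈ {1, 3}` (module docstring of `Literature/…/Motives/AimedSplitProduct`,
  `## Misstatement`, 2026-08-16; the corrected statement is printed there verbatim as the
  conclusion of `exists_cmWeilSurface_aimedSplitProduct.of_ne_one_of_ne_three` and is stated
  here, as asked there, as the named fact; every use in this route has `d = p ≥ 7`);
* `Literature.NumberTheory.Transcendental.exists_deRhamIsoFamily` — de Rham's theorem in
  multiplicative form (used once, for the Hodge bidegree `(n+1, n+1)` of `pr_A^* c ∪ pr_B^* b` —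
  the same single use as in the sibling items `ProductDescent` / `WeilDescending`).

Main results:

* `descentAt_of_deRham_of_descentPair` — Schoen's descent `2n+2 → 2n` for ONE partner surface
  carrying a descent pair, for all `p ≥ 4`, `n ≥ 1` (the general-`(p, n)` form of the landed
  `WeilSixfoldsSqrtMinus7.HyperbolicEightfoldDescent.stub_descent`, with the Künneth-for-Hodge-types
  input supplied by the multiplicative de Rham theorem as in `productDescentAt_of_deRham`);
* `aimedDescending_of_aimedSplitProduct_of_deRham` — **the two facts imply `AimedDescending`**:
  for a rational `(n,n)` Weil class `c ≠ 0` of `(A, φ)` (the case `c = 0` is trivial) the aiming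
  fact (at `d = p`, `p ≥ 7`) supplies `(B, ψ, b₊, b₋, η)` and a projective embedding `e` of
  `A × B` with a rational `a ≠ 0` making `(A × B, φ × ψ)` hyperbolic; `dim (A × B) = 2(n+1)`
  (`dim_prod`) and `(φ × ψ)² = -p` (`prodLift_comp_self_eq_neg_zsmul`), so the split rung
  hypothesis gives the algebraicity of the rational `(n+1,n+1)` Weil classes of `A × B`, and the
  descent returns `c`.

Consistency: the fact stated here IS, term for term, the corrected statement of
`Motives/AimedSplitProduct` (the conclusion of `exists_cmWeilSurface_aimedSplitProduct.of_ne_one_of_ne_three`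
there, which derives it from the unguarded def by specialisation).

The result is CONDITIONAL (D-0014): its trust base is the two named facts above; the item's own
signature is proved as soon as both are discharged (`…_holds`).
-/

noncomputable section

-- every declaration of this problem lives in `Summit.HodgeConjecture.HodgeConjecture.…`
set_option linter.dupNamespace false

open scoped Manifold
open CategoryTheory
open Literature.AlgebraicGeometry Literature.AlgebraicGeometry.HodgeTheory
open Literature.AlgebraicTopology.SingularHomology

namespace Summit.HodgeConjecture.HodgeConjecture.Theorems

/-- **Schoen's descent `2n+2 → 2n` for ONE partner surface with a descent pair, from the
multiplicative de Rham theorem** (Schoen 1998 §10, proof of the Proposition; Markman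
arXiv:2509.23403 §11.5 Step 2; Koike 2004 Thm. 2.1). Let `p ≥ 4`, `n ≥ 1`, `(A, φ)` a complex
abelian `2n`-fold and `(B, ψ)` a complex abelian surface carrying a DESCENT PAIR: eigenclasses
`b₊ ∈ Eig((𝟙+ψ)^*, (1+i√p)²)`, `b₋ ∈ Eig((𝟙+ψ)^*, (1-i√p)²)` of `H²(B(ℂ); ℂ)` with `b₊ + b₋`
rational of Hodge type `(1,1)`, and an ALGEBRAIC `η ∈ N¹H²(B(ℂ); ℂ)` with `b₊ ⌣ η ≠ 0`,
`b₋ ⌣ η ≠ 0`. IF every rational `(n+1,n+1)`-class of the Weil plane of `(A × B, φ × ψ)` is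
algebraic, THEN every rational `(n,n)`-class `c = c₊ + c₋` of the Weil plane of `(A, φ)` is
algebraic. Proof: the Hodge type `(n+1,n+1)` of `pr_A^* c ⌣ pr_B^*(b₊ + b₋)` is the multiplicative
de Rham theorem (`cupPreservesHodgeType_of_nonempty_hodgeModel`, Hodge models and independence of
`H^{p,q}` being the theorems `nonempty_hodgeModel_holds`, `hodgePQ_independent_of_hodgeModel_holds`);
the rational Weil projector (`weilEigencomponents_mem_algebraicClasses_of_rung`) makes
`pr_A^* c± ⌣ pr_B^* b±` algebraic on `A × B`; cupping with the algebraic `pr_B^* η`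
(`AbelianVariety.cupProduct_mem_algebraicClasses_one`) and pushing forward along the real Gysin
map of `pr_A` (`mem_algebraicClasses_of_complexGysin_fst_cupProduct`, fibre integrals
`pr_{A*} pr_B^*(b± ⌣ η) ≠ 0` by `complexGysin_fst_map_snd_ne_zero`) returns `c±`. Neither
`φ² = -p` nor `ψ² = -p` is used. -/
theorem descentAt_of_deRham_of_descentPair
    (hdR : ∀ (E : Type) [NormedAddCommGroup E] [NormedSpace ℂ E] [FiniteDimensional ℂ E],
      Literature.NumberTheory.Transcendental.exists_deRhamIsoFamily 𝓘(ℝ, E))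
    {p : ℕ} (hp4 : 4 ≤ p) {n : ℕ} (hn : 1 ≤ n) {A : Motives.AbelianVariety ℂ} (φ : A ⟶ A)
    (hAdim : A.dim = 2 * n) {B : Motives.AbelianVariety ℂ} (ψ : B ⟶ B) (hBdim : B.dim = 2)
    {bp bm η : complexBetti B.X 2}
    (hbp : bp ∈ Module.End.eigenspace (complexBetti.map (𝟙 B + ψ).hom.hom.hom 2).hom
      ((1 + Complex.I * (Real.sqrt (p : ℝ) : ℂ)) ^ 2))
    (hbm : bm ∈ Module.End.eigenspace (complexBetti.map (𝟙 B + ψ).hom.hom.hom 2).hom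
      ((1 - Complex.I * (Real.sqrt (p : ℝ) : ℂ)) ^ 2))
    (hbr : IsRationalClass (bp + bm)) (hbH : IsOfHodgeType 2 B.X 2 1 1 (bp + bm))
    (hη : η ∈ algebraicClasses B.X 1)
    (hpt : cupProduct (show 2 + 2 = 4 from rfl) bp η ≠ 0)
    (hmt : cupProduct (show 2 + 2 = 4 from rfl) bm η ≠ 0)
    (halgAB : ∀ u : complexBetti (A.prod B).X (2 * (n + 1)), IsRationalClass u →
      IsOfHodgeType (2 * (n + 1)) (A.prod B).X (2 * (n + 1)) (n + 1) (n + 1) u →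
      u ∈ Module.End.eigenspace (complexBetti.map (𝟙 (A.prod B) +
              Motives.AbelianVariety.prodLift (Motives.AbelianVariety.fst A B ≫ φ)
                (Motives.AbelianVariety.snd A B ≫ ψ)).hom.hom.hom (2 * (n + 1))).hom
            ((1 + Complex.I * (Real.sqrt (p : ℝ) : ℂ)) ^ (2 * (n + 1))) ⊔
          Module.End.eigenspace (complexBetti.map (𝟙 (A.prod B) +
              Motives.AbelianVariety.prodLift (Motives.AbelianVariety.fst A B ≫ φ)
                (Motives.AbelianVariety.snd A B ≫ ψ)).hom.hom.hom (2 * (n + 1))).hom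
            ((1 - Complex.I * (Real.sqrt (p : ℝ) : ℂ)) ^ (2 * (n + 1))) →
      u ∈ algebraicClasses (A.prod B).X (n + 1))
    {c : complexBetti A.X (2 * n)} (hc : IsRationalClass c)
    (hcH : IsOfHodgeType (2 * n) A.X (2 * n) n n c)
    (hcW : c ∈ Module.End.eigenspace (complexBetti.map (𝟙 A + φ).hom.hom.hom (2 * n)).hom
          ((1 + Complex.I * (Real.sqrt (p : ℝ) : ℂ)) ^ (2 * n)) ⊔
        Module.End.eigenspace (complexBetti.map (𝟙 A + φ).hom.hom.hom (2 * n)).hom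
          ((1 - Complex.I * (Real.sqrt (p : ℝ) : ℂ)) ^ (2 * n))) :
    c ∈ algebraicClasses A.X n := by
  -- smoothness witnesses and the orientation family
  have hA : Motives.IsSmoothProjective (2 * n) A.X := isSmoothProjective_of_dim_eq hAdim
  have hB : Motives.IsSmoothProjective (2 * 1) B.X := isSmoothProjective_of_dim_eq hBdim
  have hAB : Motives.IsSmoothProjective (2 * (n + 1)) (A.prod B).X :=
    isSmoothProjective_prod_two_mul hA hB
  have hABt : Motives.IsSmoothProjective (2 * n + 2 * 1) (A.prod B).X :=
    Motives.IsSmoothProjective.tensor_holds hA hB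
  let μ : OrientationFamily := fun _ _ h ↦ Classical.choice (Motives.ComplexPoints.isOrientableOver ℂ h)
  -- `c = c₊ + c₋`
  obtain ⟨cp, hcp, cm, hcm, rfl⟩ := Submodule.mem_sup.1 hcW
  rw [Module.End.mem_eigenspace_iff] at hcp hcm hbp hbm
  -- the compatible endomorphism `Φ = φ × ψ`
  set Φ : A.prod B ⟶ A.prod B := Motives.AbelianVariety.prodLift (Motives.AbelianVariety.fst A B ≫ φ)
    (Motives.AbelianVariety.snd A B ≫ ψ) with hΦ
  have h₁ : Φ ≫ Motives.AbelianVariety.fst A B = Motives.AbelianVariety.fst A B ≫ φ :=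
    Motives.AbelianVariety.prodLift_fst _ _
  have h₂ : Φ ≫ Motives.AbelianVariety.snd A B = Motives.AbelianVariety.snd A B ≫ ψ :=
    Motives.AbelianVariety.prodLift_snd _ _
  -- Hodge type `(n+1, n+1)` of `P = pr_A^* c ∪ pr_B^* b`: Hodge models and independence are theorems,
  -- the bidegree of the cup product is the multiplicative de Rham theorem
  have hI := hodgePQ_independent_of_hodgeModel_holds
  have hfst : PreservesHodgeType (2 * n + 2 * 1) (2 * n) (Motives.AbelianVariety.fst A B).hom.hom.hom :=
    preservesHodgeType_of_nonempty_hodgeModel hI nonempty_hodgeModel_holds hABt hA _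
  have hsnd : PreservesHodgeType (2 * n + 2 * 1) (2 * 1) (Motives.AbelianVariety.snd A B).hom.hom.hom :=
    preservesHodgeType_of_nonempty_hodgeModel hI nonempty_hodgeModel_holds hABt hB _
  have hcupH : CupPreservesHodgeType (2 * n + 2 * 1) (A.prod B).X :=
    cupPreservesHodgeType_of_nonempty_hodgeModel hI nonempty_hodgeModel_holds hdR hABt
  have h : 2 * n + 2 * 1 = 2 * (n + 1) := by ring
  have hbH' : IsOfHodgeType (2 * 1) B.X (2 * 1) 1 1 (bp + bm) := hbH
  have hH : IsOfHodgeType (2 * (n + 1)) (A.prod B).X (2 * (n + 1)) (n + 1) (n + 1)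
      (cupProduct h (complexBetti.map (Motives.AbelianVariety.fst A B).hom.hom.hom (2 * n) (cp + cm))
        (complexBetti.map (Motives.AbelianVariety.snd A B).hom.hom.hom (2 * 1) (bp + bm))) :=
    isOfHodgeType_cupProduct_map_fst_map_snd h hfst hsnd hcupH hcH hbH'
  -- the eigen-equations, re-typed at `2 * 1`
  have hbp' : complexBetti.map (𝟙 B + ψ).hom.hom.hom (2 * 1) bp =
      (1 + Complex.I * (Real.sqrt (p : ℝ) : ℂ)) ^ (2 * 1) • bp := hbp
  have hbm' : complexBetti.map (𝟙 B + ψ).hom.hom.hom (2 * 1) bm =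
      (1 - Complex.I * (Real.sqrt (p : ℝ) : ℂ)) ^ (2 * 1) • bm := hbm
  -- upward half: `pr_A^* c± ∪ pr_B^* b±` are algebraic on `A × B`
  obtain ⟨hP, hMm⟩ := weilEigencomponents_mem_algebraicClasses_of_rung h₁ h₂ hp4 hn h hAB halgAB
    hcp hcm hbp' hbm' hc hbr hH
  -- `pr_B^* η` is algebraic on `A × B`, hence so are `(pr_A^* c± ∪ pr_B^* b±) ∪ pr_B^* η`
  have hη' : complexBetti.map (Motives.AbelianVariety.snd A B).hom.hom.hom (2 * 1) η ∈
      algebraicClasses (A.prod B).X 1 :=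
    map_snd_mem_supportedClasses hA hB hη
  have halgp := AbelianVariety.cupProduct_mem_algebraicClasses_one (A.prod B) hP hη'
  have halgm := AbelianVariety.cupProduct_mem_algebraicClasses_one (A.prod B) hMm hη'
  -- the fibre integrals `pr_{A*} pr_B^*(b± ∪ η) ≠ 0`
  have hjj' : 2 * 1 + 2 * 1 = 2 * (2 * 1) := rfl
  have hpt' : cupProduct hjj' bp η ≠ 0 := hpt
  have hmt' : cupProduct hjj' bm η ≠ 0 := hmt
  have hnep := complexGysin_fst_map_snd_ne_zero μ hA hB hpt'
  have hnem := complexGysin_fst_map_snd_ne_zero μ hA hB hmt'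
  -- Schoen's transfer, component by component
  refine Submodule.add_mem _ ?_ ?_
  · exact mem_algebraicClasses_of_complexGysin_fst_cupProduct μ hA hB (l := n) (j := 2 * 1)
      (j' := 2 * 1) (s := 2 * (n + 1)) h hjj' hnep halgp
  · exact mem_algebraicClasses_of_complexGysin_fst_cupProduct μ hA hB (l := n) (j := 2 * 1)
      (j' := 2 * 1) (s := 2 * (n + 1)) h hjj' hnem halgm

/-- **`AimedDescending` from the two named Literature facts** — the aiming lemma of the product
trick (`exists_cmWeilSurface_aimedSplitProduct_of_ne_one_of_ne_three`: Markman arXiv:2509.23403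
§11.5 Step 2; van Geemen 1994, Lemma 5.2 (3), 5.3, 5.4 (5.4.1); Schoen 1998 §10) and de Rham's
theorem in multiplicative form (`exists_deRhamIsoFamily`). For a prime `p ≡ 3 (4)`, `p ≥ 7` (so
`p ≠ 1, 3`), `n ≥ 1`, the split rung hypothesis in dimension `2(n+1)`, an abelian `2n`-fold
`(A, φ)` with `φ ≫ φ = -p` and a rational `(n,n)` Weil class `c`: if `c = 0` it is algebraic;
otherwise `c` witnesses Weil type, the aiming fact (at `d = p`) supplies the CM Weil surface
`(B, ψ)` with its descent pair and a projective embedding `e` of `A × B` with a rational `a ≠ 0`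
making `(A × B, φ × ψ, p·e.ι^*a + (φ × ψ)^*e.ι^*a)` hyperbolic; `dim (A × B) = 2(n+1)`
(`AbelianVariety.dim_prod`) and `(φ × ψ)² = -p` (`prodLift_comp_self_eq_neg_zsmul`), so the split
rung hypothesis makes every rational `(n+1,n+1)` Weil class of `(A × B, φ × ψ)` algebraic, and
`descentAt_of_deRham_of_descentPair` returns `c` algebraic. CONDITIONAL result (D-0014): trust
base = the two named facts. -/
theorem aimedDescending_of_aimedSplitProduct_of_deRham
    (hSP : Literature.AlgebraicGeometry.Motives.exists_cmWeilSurface_aimedSplitProduct_of_ne_one_of_ne_three)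
    (hdR : ∀ (E : Type) [NormedAddCommGroup E] [NormedSpace ℂ E] [FiniteDimensional ℂ E],
      Literature.NumberTheory.Transcendental.exists_deRhamIsoFamily 𝓘(ℝ, E)) :
    Theses.HeckePrymWeil.AimedDescending := by
  intro p _ _ hp7 n hn hSplit A φ hA hφ c hrat hH hW
  by_cases hc : c = 0
  · rw [hc]
    exact Submodule.zero_mem _
  obtain ⟨B, ψ, hB, hψ, ⟨bp, bm, η, hbp, hbm, hbr, hbH, hη, hpt, hmt⟩, haim⟩ :=
    hSP p (by omega) (by omega) (by omega)
  obtain ⟨e, a, ha, ha0, hhyp⟩ := haim n A φ hA hφ ⟨c, hc, hrat, hH, hW⟩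
  have hdim : (A.prod B).dim = 2 * (n + 1) := by
    rw [Motives.AbelianVariety.dim_prod, hA, hB]
    ring
  have halgAB := hSplit (n + 1) rfl (A.prod B) _ hdim (prodLift_comp_self_eq_neg_zsmul hφ hψ) e a ha
    ha0 hhyp
  exact descentAt_of_deRham_of_descentPair hdR (by omega) hn φ hA ψ hB hbp hbm hbr hbH hη hpt hmt
    halgAB hrat hH hW

end Summit.HodgeConjecture.HodgeConjecture.Theorems

end
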